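import Literature.Analysis.FluidPDE.CompressibleEulerImplosionRates
import HarnessLib

/-!
# The CGSS implosion with rates implies the rate-free implosion corollary (theorems only)

Topic `Literature/Analysis/FluidPDE`; namespace `Literature.Analysis.FluidPDE`. Companion of
`CompressibleEulerImplosionRates.lean` (named fact `CaolaboraEtAl2025_thm12_rates`: the
Cao-Labora–Gómez-Serrano–Shi–Staffilani self-similar implosion of the monatomic gas on `𝕋³`
with its four rate clauses) and of `CompressibleEulerImplosion.lean` (named fact
`CaolaboraEtAl2025_thm12_euler γ`: the rate-free corollary "a classical isentropic solution on
`[0,T) × 𝕋³` with unbounded density"). THEOREMS ONLY, no new facts.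

* `CaolaboraEtAl2025.thm12_euler_of_rates`: `CaolaboraEtAl2025_thm12_rates` implies
  `CaolaboraEtAl2025_thm12_euler (5/3)`. The content is the last (core-growth) clause of the
  rates fact: `ρ(t, x_t) ≥ c (T−t)^{−3(1−1/r)}` with `c > 0`, `r > 1`, so `sup_x ρ(t,·) → ∞` as
  `t → T⁻` — exactly the reading of Theorem 1.2 at `y = 0` (`S̄(0) > 0`, (1.5)) by which the
  source's self-similar blow-up gives unbounded density. A route taking
  `(h : CaolaboraEtAl2025_thm12_rates)` therefore need not also take the weaker fact.

[cite: CaolaboraEtAl2025, Thm 1.2 + Rem 1.4 + Rem 1.5 + (1.5)]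
-/

noncomputable section

open Set

namespace Literature.Analysis.FluidPDE

namespace CaolaboraEtAl2025

/-- An elementary real-variable fact behind "self-similar rate ⇒ unbounded": for `c > 0`,
`β > 0` and `T > 0`, every level `M` is exceeded by `c δ^{−β}` for some `0 < δ ≤ T`. [folklore] -/
theorem exists_level_le_mul_rpow_neg {c β T : ℝ} (hc : 0 < c) (hβ : 0 < β) (hT : 0 < T)
    (M : ℝ) : ∃ δ : ℝ, 0 < δ ∧ δ ≤ T ∧ M ≤ c * δ ^ (-β) := by
  -- `K ≥ max (M/c, 1)`, `δ₀ = K^{-1/β} ∈ (0, 1]`, `δ = min δ₀ T`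
  set K : ℝ := max (M / c) 1 with hK
  have hK1 : 1 ≤ K := le_max_right _ _
  have hK0 : 0 < K := lt_of_lt_of_le one_pos hK1
  set δ₀ : ℝ := K ^ (-1 / β) with hδ₀
  have hδ₀pos : 0 < δ₀ := Real.rpow_pos_of_pos hK0 _
  refine ⟨min δ₀ T, lt_min hδ₀pos hT, min_le_right _ _, ?_⟩
  have hmin_pos : 0 < min δ₀ T := lt_min hδ₀pos hT
  -- `δ ≤ δ₀` and `x ↦ x^{-β}` is antitone on `(0, ∞)`
  have h1 : δ₀ ^ (-β) ≤ (min δ₀ T) ^ (-β) :=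
    Real.rpow_le_rpow_of_nonpos hmin_pos (min_le_left _ _) (by linarith)
  -- `δ₀^{-β} = K`
  have h2 : δ₀ ^ (-β) = K := by
    rw [hδ₀, ← Real.rpow_mul hK0.le]
    have : -1 / β * -β = 1 := by field_simp
    rw [this, Real.rpow_one]
  have h3 : M ≤ c * K := by
    have : M / c ≤ K := le_max_left _ _
    calc M = c * (M / c) := by field_simp
      _ ≤ c * K := by gcongr
  calc M ≤ c * K := h3
    _ = c * δ₀ ^ (-β) := by rw [h2]
    _ ≤ c * (min δ₀ T) ^ (-β) := by gcongr

/-- **The rates fact implies the rate-free corollary.** `CaolaboraEtAl2025_thm12_rates`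
(Cao-Labora–Gómez-Serrano–Shi–Staffilani, Thm 1.2 with Rem 1.4–1.5, `γ = 5/3`, with the Type-I,
order-`≤ 6`, floor and core-growth clauses) implies `CaolaboraEtAl2025_thm12_euler (5/3)`: the same
classical isentropic solution on `[0,T) × 𝕋³` has unbounded density, because by the core clause
`sup_x ρ(t,·) ≥ c (T−t)^{−3(1−1/r)}` with `c > 0` and `3(1 − 1/r) > 0` (`r > 1`).
[cite: CaolaboraEtAl2025, Thm 1.2 + Rem 1.4 + Rem 1.5 + (1.5)] -/
theorem thm12_euler_of_rates (h : CaolaboraEtAl2025_thm12_rates) :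
    CaolaboraEtAl2025_thm12_euler (5 / 3) := by
  intro _hγ
  obtain ⟨T, r, hT, hr, ρ, u, hsol, -, -, -, c, hc, hcore⟩ := h
  refine ⟨T, hT, ρ, u, hsol, fun M => ?_⟩
  -- the self-similar exponent `β = 3(1 − 1/r)` is positive since `r > 1`
  have hβ : 0 < 3 * (1 - 1 / r) := by
    have hr0 : 0 < r := by linarith
    have : 1 / r < 1 := by
      rw [div_lt_one hr0]
      exact hr
    linarith
  obtain ⟨δ, hδ, hδT, hM⟩ := exists_level_le_mul_rpow_neg hc hβ hT M
  -- evaluate the core clause at the time `t = T − δ ∈ [0, T)`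
  have ht : T - δ ∈ Ico 0 T := ⟨by linarith, by linarith⟩
  obtain ⟨x, hx⟩ := hcore (T - δ) ht
  refine ⟨T - δ, ht, x, le_trans ?_ hx⟩
  have hTt : T - (T - δ) = δ := by ring
  rw [hTt]
  exact hM

end CaolaboraEtAl2025

end Literature.Analysis.FluidPDE

end
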